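import Summits.QuantumFields.BalabanUV.T4Continuum.Support.NE9MajorantRoom

/-!
# NE9MajorantRoomNecessity — ROOM IS NECESSARY in the two-family pinned cluster-sum bound: under the UNDOUBLED Kotecký–Preiss clause
# there is NO constant `K` with `touchDiffSum ≤ K·ε·a(γ)` — and not even `touchDiffSum ≤ o(1)·a(γ)` as `ε → 0` (a polymer STAR);
# P-R1′-AUG-2 («a KP(m) road to (L) from `hCup` without coupling holomorphy?») closes NO at the displayed binders

Cell `pub-balaban`, T4-DAG §6 row NE9; NE9 crux team (coordinator ruling «YM REDIRECT» e34b3e0c (2)), leaf lineage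
`b2b-balaban-t4-ne9-formalise-leaf-03` generation 49; part 2 of 2 (part 1 = `NE9MajorantRoom`: room `η > 0` SUFFICES at rate `1∕η`, and the
real-analysis engine `star_real_core` ∕ `star_scale` used below).  The letter refuted here at η = 0 is the tree's ENGINE inequality behind every
coupling half of the row — `T4ActivityLipschitz.touchDiffSum_le_of_majorant` (KP for `2m` ⊢ `touchDiffSum ≤ 4·ε·a(γ)`; leaf-06's `…_sharp`: `≤ ε·a(γ)`;
= `TwoPointKP`'s `2n` clause = the record ENDs' `hkp2`) — with the DOUBLED majorant replaced by the majorant itself.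

WHAT THIS FILE PROVES (kernel; one finite incompatibility graph, real activities; nothing of Bałaban's).
* §2 **THE STAR.**  Polymers `Option (Option (Fin K))`: the PIN `none`, the CENTRE `some none`, LEAVES `some (some i)`; incompatibility
  `x ι y :⟺ x = y ∨ x = centre ∨ y = centre` (reflexive, symmetric; the centre touches everything, nothing else touches); majorant
  `m(pin) = 0`, `m(centre) = mc`, `m(leaf) = μ`; sizes `a(pin) = xc`, `a(centre) = xc + s`, `a(leaf) = 2μ` with `s = K·μ·e^{2μ}`,
  `mc·e^{xc + s} = xc`; `d = 0`.  The UNDOUBLED clause `Σ_{γ′ ι γ} m(γ′)·e^{a(γ′)} ≤ a(γ)` holds at EVERY polymer as soon as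
  `xc + μ·e^{2μ} ≤ 2μ` (`star_kp`; at the pin `0 + xc ≤ xc`, at the centre with equality); the partition functions are
  `Z(univ; −t·m) = (1 − tμ)^K − t·mc` and `Z(off pin; −t·m) = (1 − tμ)^K` (`star_Z_univ`, `star_Z_off` — delete the centre, multiply out the
  pairwise compatible rest), so by part 1 §0 `Σ_{C ι pin} Φ^T(C; −t·m) = log(1 − t·mc·(1 − tμ)^{−K})` in closed form and
  `star_touchDiffSum_ge_core`: `(1 − t₀)(1 + Kμ)·xc·e^{−(xc+s)+t₀Kμ} ≤ touchDiffSum (−m) (−t₀·m)`.  At scale `n ≥ 1` — `K = 8n²`, `μ = 1∕(8n)`,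
  `xc = 1∕(16n)`, `t₀ = 1 − 1∕(4n)` (so `‖wA − wB‖ = ε·m`, `ε = 1∕(4n)`) — **`star_touchDiffSum_ge`: `touchDiffSum ≥ a(pin)∕12`** for EVERY `n`.
  MECHANISM: the clusters {centre} + a multiset of leaves carry multiplicity `|n| ≈ Kμ = n`, while the pin's size `a(pin) = xc` pays for the
  centre ONCE: [KP86] (4) controls the VALUE of a pinned cluster sum at the boundary of the KP region, not its activity-DERIVATIVE.
* §3 **ROOM IS NECESSARY.**  `exists_star_touchDiffSum_ge`: for EVERY `ε > 0` an instance of ALL the binders of `touchDiffSum_le_of_majorant`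
  EXCEPT that the KP clause is for `m` (not `2m`), with `0 < a(γ)` and `a(γ)∕12 ≤ touchDiffSum` — NO modulus of continuity in units of
  `a(γ)`; hence **`not_exists_const_touchDiffSum_le_of_majorant`**: `¬ ∃ K, ∀ (P, inc, wA, wB, m, a, d, L, ε, γ) obeying those binders,
  touchDiffSum ≤ K·ε·a(γ)` — the tree theorem's statement with `2·m γ′ ↦ m γ′`, `4 ↦ K` is FALSE for every `K` (quantified over
  `P : Type`; the universe-polymorphic schema is refuted a fortiori).  With part 1 §1: room `η` is SUFFICIENT for every `η > 0` (rate
  `1∕η`) and NECESSARY (η = 0 fails at every constant).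
READING FOR THE DESK (a reading, not a theorem).  (i) With `Literature.Probability.LatticeModels.TruncatedWeightLipschitz` (same `a, d`,
NO doubling ⊢ the GLOBAL bound `Σ_{C ⊆ L} ‖ΔΦ^T‖e^{d(C)} ≤ Σ_{δ ∈ L} ‖wA δ − wB δ‖e^{a δ + d δ}` and its SURPLUS-anchored local form) this
locates the doubling exactly: the undoubled clause controls the two-family sum GLOBALLY (whole-volume discrepancy) and LOCALLY only through
a SURPLUS decay weight; what fails is localisation to the pin's OWN size `a(γ)` — the currency in which `PinBudget a δ B κ` turns the
coupling half into `e^{−κ d(X)}·B`-letters.  (ii) P-R1′-AUG-2: every road to (L) in the cluster-sum currency needs ROOM — in the majorant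
(`hkp2` = η = 1; any η > 0 at rate 1∕η), in a complex coupling disc (route R1′♯-AUG's augmented pencil, KP for `m` on `Pot × ℂ`), or in a
decay surplus (the Literature file's anchored form) — and «PotentialKPG's own clause + `hCup`» is NONE of these: the star realises `hCup`
with `clip·|g − g′| = ε` and the undoubled clause at BOTH couplings (activities constant in the potential, `d = 0`, `δ = 0`, pin budget
`B = a(pin)`), where (L)'s coupling constant would have to exceed `clip·B∕(12·ε)` for every `ε` — unbounded in the displayed letters.
So P-R1′-AUG-2 closes **NO** (no KP(m) road at the displayed binders) and route R1′♯-AUG is NOT dominated on this account: it pays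
the same room in another currency; `hkp2` (or any `(1+η)·m`, or a surplus letter) stays LOAD-BEARING in D2 ∕ E134 ∕ the `TwoPointKP` ENDs.
HONEST FRAMING (T4-DAG PAGE 1).  Rung (B)+1 of the FINITE-VOLUME T⁴ programme — NOT infinite volume, NOT a mass gap, NOT the Clay
problem.  NE9 is a cell NEW ESTIMATE, NOT PRINTED in [Balaban1987RG1] (CMP **109**) ∕ [Balaban1988RG2Cluster] (CMP **116**), NOT PROVED for
Bałaban's E^{(j)}; the row is WALLED ON A MODEL (O-NE9-1); spine PROVED 0∕9.  A no-go about the ABSTRACT engine and a pricing answer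
INSIDE a conditional reduction are NOT progress on the estimate.  HONEST DEPENDENCY (cell line, verbatim): continuum YM on T⁴ ⇐
BetaPertH ∧ nine spine estimates (0/9 proved); BetaPertH ⇐ (D1) ∧ (D4) ∧ CAP+tail; G-an2-4 gates asym, D1 and NE2/3/4.
`FlowStep.BetaPertH`, (B), (B^μ) do not occur; [KP86] for the TYPE of the clause only (ABSOLUTE RULE).  0 sorry; four `def`s (the star's
incompatibility, majorant, sizes, activities — the data of a COUNTEREXAMPLE, no object of Bałaban's or of MODEL O-NE9-1) and three
instances.  Summits-side NEW work (LEAN PLACEMENT RULE); imports part 1 BY NAME; modifies nothing; no END re-wired.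
References (TYPES only): [KoteckyPreiss1986] R. Kotecký, D. Preiss, CMP **103** (1986) 491–498, Theorem p. 492 (1), (4);
[Balaban1988RG2Cluster] T. Bałaban, CMP **116** (1988) 1–22, (2.13)–(2.15) pp. 14–15, (2.40)–(2.41) p. 21.
-/

noncomputable section

namespace Summit.QuantumFields.BalabanUV.T4Continuum.NE9MajorantRoomNecessity

open scoped BigOperators
open Metric Set
open Literature.Probability.LatticeModels
open Literature.MathematicalPhysics.QuantumFieldTheory.Balaban1983to89.T4ActivityLipschitz
open Summit.QuantumFields.BalabanUV.T4Continuum.NE9MajorantRoom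

/-! ## §2 THE STAR: the undoubled clause holds, and the pinned two-family sum is `≥ a(pin)∕12` at rate `ε = 1∕(4n)` -/

section Star

variable (K : ℕ)

/-- The star's incompatibility on `Option (Option (Fin K))` — PIN `none`, CENTRE `some none`, LEAVES `some (some i)`:
`x ι y :⟺ x = y ∨ x = centre ∨ y = centre` (the centre touches everything; pin and leaves touch only themselves and the centre). -/
def starInc (x y : Option (Option (Fin K))) : Prop := x = y ∨ x = some none ∨ y = some none

/-- Decidability of the star's incompatibility (three decidable equalities). -/
instance starInc.instDecidableRel : DecidableRel (starInc K) := fun x y =>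
  inferInstanceAs (Decidable (x = y ∨ x = some none ∨ y = some none))

/-- The star's incompatibility is reflexive. -/
instance starInc.instRefl : Std.Refl (starInc K) := ⟨fun _ => Or.inl rfl⟩

/-- The star's incompatibility is symmetric. -/
instance starInc.instSymm : Std.Symm (starInc K) :=
  ⟨fun x y h => by rcases h with h | h | h; exacts [Or.inl h.symm, Or.inr (Or.inr h), Or.inr (Or.inl h)]⟩

/-- The star's majorant: `0` at the pin, `mc` at the centre, `μ` at every leaf. -/
def starM (μ mc : ℝ) : Option (Option (Fin K)) → ℝ
  | none => 0
  | some none => mc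
  | some (some _) => μ

/-- The star's size function: `xc` at the pin, `xc + s` at the centre, `2μ` at every leaf. -/
def starA (μ xc s : ℝ) : Option (Option (Fin K)) → ℝ
  | none => xc
  | some none => xc + s
  | some (some _) => 2 * μ

/-- The star's REAL NONPOSITIVE activities at dilation `t`: `w_t = −t·m`. -/
def starW (μ mc t : ℝ) (γ : Option (Option (Fin K))) : ℂ := -((t * starM K μ mc γ : ℝ) : ℂ)

/-- The majorant is nonnegative when `μ, mc ≥ 0`. -/
theorem starM_nonneg {μ mc : ℝ} (hμ : 0 ≤ μ) (hmc : 0 ≤ mc) (γ : Option (Option (Fin K))) : 0 ≤ starM K μ mc γ := by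
  rcases γ with _ | _ | _ <;> simp [starM, hμ, hmc]

/-- A sum over the polymers incompatible with `γ`, split as pin + centre + leaves. -/
theorem star_sum_filter (f : Option (Option (Fin K)) → ℝ) (γ : Option (Option (Fin K))) :
    ∑ γ' ∈ Finset.univ with starInc K γ' γ, f γ' =
      (if starInc K none γ then f none else 0) + ((if starInc K (some none) γ then f (some none) else 0) +
        ∑ i : Fin K, if starInc K (some (some i)) γ then f (some (some i)) else 0) := by
  rw [Finset.sum_filter, Fintype.sum_option, Fintype.sum_option]

/-- **THE UNDOUBLED KP CLAUSE HOLDS ON THE STAR** (`d = 0`), given `mc·e^{xc+s} = xc`, `s = K·μ·e^{2μ}` and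
`xc + μ·e^{2μ} ≤ 2μ`: at the pin the clause reads `0 + xc ≤ xc`, at the centre `xc + K·μ·e^{2μ} ≤ xc + s`, at a leaf
`xc + μ·e^{2μ} ≤ 2μ`. -/
theorem star_kp {μ xc s mc : ℝ} (hmc : mc * Real.exp (xc + s) = xc) (hs : s = K * (μ * Real.exp (2 * μ)))
    (hleaf : xc + μ * Real.exp (2 * μ) ≤ 2 * μ) :
    ∀ γ ∈ (Finset.univ : Finset (Option (Option (Fin K)))),
      ∑ γ' ∈ Finset.univ with starInc K γ' γ, starM K μ mc γ' * Real.exp (starA K μ xc s γ' + 0) ≤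
        starA K μ xc s γ := by
  intro γ _
  rw [star_sum_filter]
  rcases γ with _ | _ | i
  · simp [starInc, starM, starA, hmc]
  · simp only [starInc, starM, starA, or_true, if_true, add_zero, zero_mul, zero_add, hmc, Finset.sum_const,
      Finset.card_univ, Fintype.card_fin, nsmul_eq_mul]
    rw [hs]
  · simp [starInc, starM, starA, hmc, Finset.sum_ite_eq', add_comm, hleaf]

/-- `IsKPVolume` for the star's activities `w_t`, `0 ≤ t ≤ 1`, with the star's size function (from `star_kp`: `‖w_t‖ = t·m ≤ m`). -/
theorem star_isKPVolume {μ xc s mc t : ℝ} (hμ : 0 ≤ μ) (hmc0 : 0 ≤ mc) (hmc : mc * Real.exp (xc + s) = xc)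
    (hs : s = K * (μ * Real.exp (2 * μ))) (hleaf : xc + μ * Real.exp (2 * μ) ≤ 2 * μ) (ht0 : 0 ≤ t) (ht1 : t ≤ 1) :
    IsKPVolume (starInc K) (starW K μ mc t) (starA K μ xc s) Finset.univ := by
  intro γ hγ
  refine le_trans (Finset.sum_le_sum fun γ' _ => ?_) (star_kp K hmc hs hleaf γ hγ)
  rw [add_zero]
  unfold kpTerm
  refine mul_le_mul_of_nonneg_right ?_ (Real.exp_nonneg _)
  have hm : 0 ≤ starM K μ mc γ' := starM_nonneg K hμ hmc0 γ'
  rw [starW, norm_neg, Complex.norm_real, Real.norm_eq_abs, abs_of_nonneg (mul_nonneg ht0 hm)]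
  exact mul_le_of_le_one_left hm ht1

/-- For the star's (real) activities in the KP region the Kotecký–Preiss logarithm of every sub-volume is the REAL logarithm
of a POSITIVE partition function. -/
theorem star_logZ {μ xc s mc t : ℝ} (hμ : 0 ≤ μ) (hmc0 : 0 ≤ mc) (hmc : mc * Real.exp (xc + s) = xc)
    (hs : s = K * (μ * Real.exp (2 * μ))) (hleaf : xc + μ * Real.exp (2 * μ) ≤ 2 * μ) (ht0 : 0 ≤ t) (ht1 : t ≤ 1)
    (B : Finset (Option (Option (Fin K)))) :
    0 < (polymerPartitionFunction (starInc K) (starW K μ mc t) B).re ∧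
      polymerLogZ (starInc K) (starW K μ mc t) B =
        (Real.log (polymerPartitionFunction (starInc K) (starW K μ mc t) B).re : ℂ) :=
  polymerLogZ_eq_log_of_real (fun γ => by simp [starW]) fun r hr =>
    polymerPartitionFunction_ne_zero_of_kp ((star_isKPVolume K hμ hmc0 hmc hs hleaf ht0 ht1).ray hr)
      (Finset.subset_univ B)

/-- **The star's partition function in closed form**: `Z(univ; −t·m) = (1 − tμ)^K − t·mc` (delete the centre — incompatible with
everything, `polymerPartitionFunction_insert` — and multiply out the pairwise compatible rest, the pin contributing `1 + 0`). -/
theorem star_Z_univ (μ mc t : ℝ) :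
    polymerPartitionFunction (starInc K) (starW K μ mc t) Finset.univ = (((1 - t * μ) ^ K - t * mc : ℝ) : ℂ) := by
  have huniv : (Finset.univ : Finset (Option (Option (Fin K)))) =
      insert (some none) (Finset.univ.filter fun γ => γ ≠ some none) := by
    ext x; by_cases hx : x = some none <;> simp [hx]
  have hc : (some none : Option (Option (Fin K))) ∉
      (Finset.univ.filter fun γ : Option (Option (Fin K)) => γ ≠ some none) := by
    simp
  rw [huniv, polymerPartitionFunction_insert inc_symm_of_symm _ hc]
  have hfilter : ((Finset.univ.filter fun γ : Option (Option (Fin K)) => γ ≠ some none).filter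
      fun γ' => ¬ starInc K (some none) γ') = ∅ := by
    ext x; simp [starInc]
  rw [hfilter, polymerPartitionFunction_empty, mul_one,
    polymerPartitionFunction_eq_prod_one_add _ (fun x hx y hy hxy => ?_)]
  · rw [Finset.prod_filter, Fintype.prod_option, Fintype.prod_option]
    simp [starW, starM, Finset.prod_const, Finset.card_univ, Fintype.card_fin]
    ring
  · have hx' : x ≠ some none := (Finset.mem_filter.1 hx).2
    have hy' : y ≠ some none := (Finset.mem_filter.1 hy).2
    rintro (h | h | h)
    exacts [hxy h, hx' h, hy' h]

/-- **The partition function off the pin**: the polymers compatible with the pin are the leaves, `Z(leaves; −t·m) = (1 − tμ)^K`. -/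
theorem star_Z_off (μ mc t : ℝ) :
    polymerPartitionFunction (starInc K) (starW K μ mc t) (Finset.univ.filter fun γ' => ¬ starInc K γ' none) =
      (((1 - t * μ) ^ K : ℝ) : ℂ) := by
  rw [polymerPartitionFunction_eq_prod_one_add _ (fun x hx y hy hxy => ?_)]
  · rw [Finset.prod_filter, Fintype.prod_option, Fintype.prod_option]
    simp [starInc, starW, starM, Finset.prod_const, Finset.card_univ, Fintype.card_fin]
    ring
  · have hx' : x ≠ some none := fun h => (Finset.mem_filter.1 hx).2 (Or.inr (Or.inl h))
    have hy' : y ≠ some none := fun h => (Finset.mem_filter.1 hy).2 (Or.inr (Or.inl h))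
    rintro (h | h | h)
    exacts [hxy h, hx' h, hy' h]

/-- **The pinned two-family sum dominates the log-ratio difference, in closed form.**  Under the star's clause data and
`0 ≤ t₀ ≤ 1`: the four partition functions `Z₁ = (1−μ)^K − mc`, `q₁ = (1−μ)^K`, `Z₀ = (1−t₀μ)^K − t₀·mc`, `q₀ = (1−t₀μ)^K` are
positive and `(log Z₀ − log q₀) − (log Z₁ − log q₁) ≤ touchDiffSum (star) (−m) (−t₀·m) 0 univ pin` (§0 + `star_logZ` + closed forms). -/
theorem star_logRatio_le_touchDiffSum {μ xc s mc t₀ : ℝ} (hμ0 : 0 ≤ μ) (hmc0 : 0 ≤ mc)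
    (hmcxc : mc * Real.exp (xc + s) = xc) (hs : s = K * (μ * Real.exp (2 * μ)))
    (hleaf : xc + μ * Real.exp (2 * μ) ≤ 2 * μ) (ht0 : 0 ≤ t₀) (ht1 : t₀ ≤ 1) :
    0 < (1 - 1 * μ) ^ K - 1 * mc ∧ 0 < (1 - 1 * μ) ^ K ∧ 0 < (1 - t₀ * μ) ^ K - t₀ * mc ∧ 0 < (1 - t₀ * μ) ^ K ∧
      (Real.log ((1 - t₀ * μ) ^ K - t₀ * mc) - Real.log ((1 - t₀ * μ) ^ K)) -
          (Real.log ((1 - 1 * μ) ^ K - 1 * mc) - Real.log ((1 - 1 * μ) ^ K)) ≤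
        touchDiffSum (starInc K) (starW K μ mc 1) (starW K μ mc t₀) (fun _ => 0) Finset.univ none := by
  have hL1 := star_logZ K hμ0 hmc0 hmcxc hs hleaf zero_le_one le_rfl Finset.univ
  have hL1' := star_logZ K hμ0 hmc0 hmcxc hs hleaf zero_le_one le_rfl
    (Finset.univ.filter fun γ' => ¬ starInc K γ' none)
  have hL0 := star_logZ K hμ0 hmc0 hmcxc hs hleaf ht0 ht1 Finset.univ
  have hL0' := star_logZ K hμ0 hmc0 hmcxc hs hleaf ht0 ht1 (Finset.univ.filter fun γ' => ¬ starInc K γ' none)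
  rw [star_Z_univ, Complex.ofReal_re] at hL1 hL0
  rw [star_Z_off, Complex.ofReal_re] at hL1' hL0'
  obtain ⟨hZ₁pos, hlogZ₁⟩ := hL1
  obtain ⟨hq₁pos, hlogq₁⟩ := hL1'
  obtain ⟨hZ₀pos, hlogZ₀⟩ := hL0
  obtain ⟨hq₀pos, hlogq₀⟩ := hL0'
  refine ⟨hZ₁pos, hq₁pos, hZ₀pos, hq₀pos, ?_⟩
  have hdom := norm_sub_le_touchDiffSum (inc := starInc K) (starW K μ mc 1) (starW K μ mc t₀) (d := fun _ => (0 : ℝ))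
    (fun _ => le_rfl) Finset.univ none
  rw [hlogZ₁, hlogq₁, hlogZ₀, hlogq₀, ← Complex.ofReal_sub, ← Complex.ofReal_sub, ← Complex.ofReal_sub, Complex.norm_real,
    Real.norm_eq_abs] at hdom
  rw [← neg_sub]
  exact (neg_le_abs _).trans hdom

/-- **CORE LOWER BOUND** (general parameters).  `0 ≤ μ < 1`, `0 ≤ xc`, `mc = xc·e^{−(xc+s)}`, `s = K·μ·e^{2μ}`, the leaf clause
`xc + μ·e^{2μ} ≤ 2μ`, `0 ≤ t₀ ≤ 1`; families `wA = −m`, `wB = −t₀·m`.  Then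
`(1 − t₀)·(1 + K·μ)·xc·e^{−(xc+s) + t₀·K·μ} ≤ touchDiffSum (star) wA wB 0 univ pin` (`star_real_core` ∘ `star_logRatio_le_touchDiffSum`). -/
theorem star_touchDiffSum_ge_core {μ xc s mc t₀ : ℝ} (hμ0 : 0 ≤ μ) (hμ1 : μ < 1) (hxc : 0 ≤ xc)
    (hmc : mc = xc * Real.exp (-(xc + s))) (hs : s = K * (μ * Real.exp (2 * μ)))
    (hleaf : xc + μ * Real.exp (2 * μ) ≤ 2 * μ) (ht0 : 0 ≤ t₀) (ht1 : t₀ ≤ 1) :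
    (1 - t₀) * (1 + K * μ) * (xc * Real.exp (-(xc + s) + t₀ * (K * μ))) ≤
      touchDiffSum (starInc K) (starW K μ mc 1) (starW K μ mc t₀) (fun _ => 0) Finset.univ none := by
  have hmcxc : mc * Real.exp (xc + s) = xc := by
    rw [hmc, mul_assoc, ← Real.exp_add, neg_add_cancel, Real.exp_zero, mul_one]
  have hmc0 : 0 ≤ mc := by rw [hmc]; positivity
  obtain ⟨hZ₁pos, -, hZ₀pos, -, hdom⟩ := star_logRatio_le_touchDiffSum K hμ0 hmc0 hmcxc hs hleaf ht0 ht1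
  exact (star_real_core K hμ0 hμ1 hxc hmc ht0 ht1 hZ₁pos hZ₀pos).trans hdom

/-- **THE STAR AT SCALE `n`**: `K = 8n²` leaves, `μ = 1∕(8n)`, `xc = 1∕(16n)` (= `a(pin)`), `s = K·μ·e^{2μ}`, `mc = xc·e^{−(xc+s)}`,
`wA = −m`, `wB = −(1 − 1∕(4n))·m` (rate `ε = 1∕(4n)`): `touchDiffSum ≥ a(pin)∕12` for every `n ≥ 1`. -/
theorem star_touchDiffSum_ge (n : ℕ) (hn : 1 ≤ n) :
    (1 / (16 * n) : ℝ) / 12 ≤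
      touchDiffSum (starInc (8 * n ^ 2))
        (starW (8 * n ^ 2) (1 / (8 * n)) (1 / (16 * n) * Real.exp (-(1 / (16 * n) +
          (8 * n ^ 2 : ℕ) * (1 / (8 * n) * Real.exp (2 * (1 / (8 * n))))))) 1)
        (starW (8 * n ^ 2) (1 / (8 * n)) (1 / (16 * n) * Real.exp (-(1 / (16 * n) +
          (8 * n ^ 2 : ℕ) * (1 / (8 * n) * Real.exp (2 * (1 / (8 * n))))))) (1 - 1 / (4 * n)))
        (fun _ => 0) Finset.univ none := by
  obtain ⟨hnpos, hμ8, hxc16, hKμ, hnμ, h4n, hleaf, ht0, hexp⟩ := star_scale n hn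
  set μ : ℝ := 1 / (8 * n) with hμ
  set xc : ℝ := 1 / (16 * n) with hxc
  set s : ℝ := (8 * n ^ 2 : ℕ) * (μ * Real.exp (2 * μ)) with hs
  set t₀ : ℝ := 1 - 1 / (4 * n) with ht₀
  have hμ0 : 0 ≤ μ := by positivity
  have hμ1 : μ < 1 := by linarith
  have ht1 : t₀ ≤ 1 := by rw [ht₀]; linarith [show (0 : ℝ) ≤ 1 / (4 * n) by positivity]
  have hcore := star_touchDiffSum_ge_core (8 * n ^ 2) (t₀ := t₀) hμ0 hμ1 (by positivity) rfl hs hleaf ht0 ht1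
  refine le_trans ?_ hcore
  -- numerics: `(1 − t₀)(1 + n) ≥ 1/4`, exponent `≥ −13/16`, `e^{−13/16} ≥ 1/3`
  have hfac : (1 : ℝ) / 4 ≤ (1 - t₀) * (1 + (8 * n ^ 2 : ℕ) * μ) := by
    rw [hKμ, ht₀, sub_sub_cancel, mul_add, mul_one, h4n]
    linarith [show (0 : ℝ) ≤ 1 / (4 * n) by positivity]
  have hexpo : -(13 / 16 : ℝ) ≤ -(xc + s) + t₀ * ((8 * n ^ 2 : ℕ) * μ) := by
    have hns : s = n * Real.exp (2 * μ) := by rw [hs, ← mul_assoc, hKμ]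
    rw [hKμ, hns, ht₀, sub_mul, one_mul, h4n]
    nlinarith [mul_le_mul_of_nonneg_left hexp hnpos.le]
  calc (1 / (16 * n) : ℝ) / 12 = 1 / 4 * (xc * (1 / 3)) := by rw [hxc]; ring
    _ ≤ (1 - t₀) * (1 + (8 * n ^ 2 : ℕ) * μ) * (xc * Real.exp (-(xc + s) + t₀ * ((8 * n ^ 2 : ℕ) * μ))) := by
        refine mul_le_mul hfac (mul_le_mul_of_nonneg_left ?_ (by positivity)) (by positivity)
          (le_trans (by norm_num) hfac)
        exact third_le_exp_neg.trans (Real.exp_le_exp.2 hexpo)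

end Star

/-! ## §3 ROOM IS NECESSARY: no modulus of continuity, hence no constant, under the undoubled clause -/

/-- **For EVERY rate `ε > 0` an instance of all the binders of `touchDiffSum_le_of_majorant` with the KP clause for `m` (NOT `2m`)
on which the pinned two-family sum is `≥ a(γ)∕12 > 0`** — the star at scale `n ≥ 1∕(4ε)`.  So under the undoubled clause the
two-family pinned sum admits NO modulus of continuity in units of `a(γ)` as `ε → 0`. -/
theorem exists_star_touchDiffSum_ge {ε : ℝ} (hε : 0 < ε) :
    ∃ (P : Type) (_ : DecidableEq P) (inc : P → P → Prop) (_ : DecidableRel inc) (_ : Std.Refl inc) (_ : Std.Symm inc)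
      (wA wB : P → ℂ) (m a d : P → ℝ) (L : Finset P) (γ : P),
      (∀ γ, 0 ≤ a γ) ∧ (∀ γ, 0 ≤ d γ) ∧ (∀ γ ∈ L, ‖wA γ‖ ≤ m γ) ∧ (∀ γ ∈ L, ‖wB γ‖ ≤ m γ) ∧
      (∀ γ ∈ L, ‖wA γ - wB γ‖ ≤ ε * m γ) ∧
      (∀ γ ∈ L, ∑ γ' ∈ L with inc γ' γ, m γ' * Real.exp (a γ' + d γ') ≤ a γ) ∧
      γ ∈ L ∧ 0 < a γ ∧ a γ / 12 ≤ touchDiffSum inc wA wB d L γ := by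
  -- the scale
  obtain ⟨n, hn1, hnε⟩ : ∃ n : ℕ, 1 ≤ n ∧ 1 / (4 * (n : ℝ)) ≤ ε := by
    refine ⟨⌈1 / (4 * ε)⌉₊ + 1, by omega, ?_⟩
    have h1 : 1 / (4 * ε) ≤ (⌈1 / (4 * ε)⌉₊ : ℝ) := Nat.le_ceil _
    rw [div_le_iff₀ (by positivity)]
    push_cast
    have : 1 / (4 * ε) * (4 * ε) = 1 := by rw [one_div, inv_mul_cancel₀ (by positivity)]
    nlinarith
  obtain ⟨hnpos, hμ8, hxc16, hKμ, hnμ, h4n, hleaf, ht0, -⟩ := star_scale n hn1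
  set K : ℕ := 8 * n ^ 2 with hK
  set μ : ℝ := 1 / (8 * n) with hμ
  set xc : ℝ := 1 / (16 * n) with hxc
  set s : ℝ := (8 * n ^ 2 : ℕ) * (μ * Real.exp (2 * μ)) with hs
  set mc : ℝ := xc * Real.exp (-(xc + s)) with hmc
  set t₀ : ℝ := 1 - 1 / (4 * n) with ht₀
  have hμ0 : 0 ≤ μ := by positivity
  have hmc0 : 0 ≤ mc := by positivity
  have hmcxc : mc * Real.exp (xc + s) = xc := by
    rw [hmc, mul_assoc, ← Real.exp_add, neg_add_cancel, Real.exp_zero, mul_one]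
  have ht1 : t₀ ≤ 1 := by rw [ht₀]; linarith [show (0 : ℝ) ≤ 1 / (4 * n) by positivity]
  have hm0 : ∀ γ, 0 ≤ starM K μ mc γ := starM_nonneg K hμ0 hmc0
  refine ⟨Option (Option (Fin K)), inferInstance, starInc K, inferInstance, inferInstance, inferInstance,
    starW K μ mc 1, starW K μ mc t₀, starM K μ mc, starA K μ xc s, fun _ => 0, Finset.univ, none,
    ?_, fun _ => le_rfl, ?_, ?_, ?_, star_kp K hmcxc hs hleaf, Finset.mem_univ _, ?_, ?_⟩
  · intro γ; rcases γ with _ | _ | _ <;> simp only [starA] <;> positivity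
  · intro γ _; rw [starW, one_mul, norm_neg, Complex.norm_real, Real.norm_of_nonneg (hm0 γ)]
  · intro γ _
    rw [starW, norm_neg, Complex.norm_real, Real.norm_of_nonneg (mul_nonneg ht0 (hm0 γ))]
    exact mul_le_of_le_one_left (hm0 γ) ht1
  · intro γ _
    rw [starW, starW, neg_sub_neg, ← Complex.ofReal_sub, Complex.norm_real, one_mul, ← sub_one_mul, norm_mul,
      Real.norm_of_nonneg (hm0 γ), Real.norm_eq_abs, abs_sub_comm, abs_of_nonneg (sub_nonneg.2 ht1)]
    refine mul_le_mul_of_nonneg_right ?_ (hm0 γ)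
    rw [ht₀, sub_sub_cancel]; exact hnε
  · show (0 : ℝ) < xc; positivity
  · exact star_touchDiffSum_ge n hn1

/-- **THE DOUBLED MAJORANT CANNOT BE DROPPED AT ANY CONSTANT.**  There is NO `K : ℝ` such that, for every finite polymer system with
reflexive symmetric incompatibility, every `a, d ≥ 0`, `ε ≥ 0`, majorant `m` dominating `wA`, `wB` on `L` with `‖wA − wB‖ ≤ ε·m`
and the UNDOUBLED `d`-weighted KP clause `Σ_{γ′ ∈ L, γ′ ι γ} m γ′·e^{a γ′ + d γ′} ≤ a γ` on `L`, one has
`touchDiffSum inc wA wB d L γ ≤ K·ε·a(γ)` for `γ ∈ L` — the statement of `T4ActivityLipschitz.touchDiffSum_le_of_majorant` with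
`2·m γ′ ↦ m γ′` and `4 ↦ K` is FALSE for every `K` (the star of §2 at rate `ε = 1∕(24·(|K|+1))`). -/
theorem not_exists_const_touchDiffSum_le_of_majorant :
    ¬ ∃ Kc : ℝ, ∀ (P : Type) [DecidableEq P] (inc : P → P → Prop) [DecidableRel inc] [Std.Refl inc] [Std.Symm inc]
      (wA wB : P → ℂ) (m a d : P → ℝ) (L : Finset P) (ε : ℝ) (γ : P),
      (∀ γ, 0 ≤ a γ) → (∀ γ, 0 ≤ d γ) → 0 ≤ ε → (∀ γ ∈ L, ‖wA γ‖ ≤ m γ) → (∀ γ ∈ L, ‖wB γ‖ ≤ m γ) →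
      (∀ γ ∈ L, ‖wA γ - wB γ‖ ≤ ε * m γ) →
      (∀ γ ∈ L, ∑ γ' ∈ L with inc γ' γ, m γ' * Real.exp (a γ' + d γ') ≤ a γ) →
      γ ∈ L → touchDiffSum inc wA wB d L γ ≤ Kc * ε * a γ := by
  rintro ⟨Kc, h⟩
  set ε : ℝ := 1 / (24 * (|Kc| + 1)) with hε
  have hεpos : 0 < ε := by positivity
  obtain ⟨P, _, inc, _, _, _, wA, wB, m, a, d, L, γ, ha, hd, hA, hB, hAB, hKP, hγ, haγ, hbig⟩ :=
    exists_star_touchDiffSum_ge hεpos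
  have hle := h P inc wA wB m a d L ε γ ha hd hεpos.le hA hB hAB hKP hγ
  have h1 : Kc * ε * a γ ≤ |Kc| * ε * a γ :=
    mul_le_mul_of_nonneg_right (mul_le_mul_of_nonneg_right (le_abs_self Kc) hεpos.le) haγ.le
  have h2 : |Kc| * ε ≤ 1 / 24 := by
    rw [hε, mul_one_div, div_le_div_iff₀ (by positivity) (by norm_num)]
    nlinarith [abs_nonneg Kc]
  nlinarith

end Summit.QuantumFields.BalabanUV.T4Continuum.NE9MajorantRoomNecessity
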